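import Literature.Topology.FourManifolds.BandSum
import Literature.Topology.FourManifolds.ArcClosing
import Literature.Topology.FourManifolds.LoopGeneralPositionTwoArcs
import Literature.Topology.FourManifolds.LinkTubularUniqueness
import HarnessLib

/-!
# The core loop of a band joining two knots: tubes, path reduction, two germs, general position

Topic `Literature/Topology/FourManifolds` (trunk T-4MAN). Fact seat
`provefact-Literature.Topology.FourManifolds.Knot.exists_isBandSum` (`BandSum.lean`: existence of
band sums of disjoint knots along a band avoiding a closed set `avoid`, R. E. Gompf,
A. I. Stipsicz, *4-Manifolds and Kirby Calculus* (1999), §5.1).  The band is a thickening of an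
embedded **core arc** from the point `p₁ = K₁ (1, 0)` to the point `p₂ = K₂ (1, 0)` which leaves
`p₁` and arrives at `p₂` along straight radial segments of tubular neighbourhoods of the two
knots, and in between runs through the open set `O = avoidᶜ ∖ (K₁ ∪ K₂)`.  This file produces
the core arc as half of a smoothly embedded circle (`exists_coreLoop`):

* `isPathConnected_ball_diff_zero` — the punctured disc in `ℝ²` is path connected;
* `Knot.TubularNbhd.exists_radius_forall_notMem` — a closed set missing the knot misses a closed
  tube `ν (S¹ × B̄(0, r))` about it (tube lemma over the compact circle);
  `isCompact_image_closedTube`, `isOpen_image_openTube`, `joinedIn_image_punctured` — closed tubes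
  are compact, open tubes are open, the punctured open tube `ν (S¹ × (B(0, r) ∖ 0))` is path
  connected;
* `exists_joinedIn_of_path` — **path reduction**: a path from a closed set `A` to a disjoint
  closed set `B` contains a sub-path from a point near `A` (inside a prescribed neighbourhood,
  off `A`) to a point near `B`, all of whose points lie off `A ∪ B` (last exit from `A`, first
  subsequent entry into `B`: suprema and infima over compact sets of parameters);
* `Knot.TubularNbhd.contMDiff_radial`, `injective_radial`, `injective_mfderiv_radial` — the
  **radial segment** `t ↦ ν ((1, 0), (κ t) e₀)` through the base point of the knot is a smooth
  injective immersion;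
* `exists_periodic_extension_two_germs` — a continuous `2π`-periodic map which is `σ₁` on `[-1, 1]`,
  `σ₂ (· - π)` on `[π - 1, π + 1]` and runs through given paths in between;
* `exists_loop_two_germs`, `exists_embedding_two_germs` — the two-germ version of the tree's
  arc-closing lemma (`ArcClosing.lean`, Milnor (1965), proof of Lemma 8.3 with Whitney's Lemma
  6.12): two disjoint germs of embedded arcs `σ₁`, `σ₂` whose non-central points lie in an open
  set `O`, with ends joined in `O`, close up to a smoothly embedded circle equal to `σ₁` near the
  angle `0` and to `σ₂` near the angle `π`, otherwise in `O` (continuous loop, smoothing relative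
  to the two arcs by `exists_contMDiff_eqOn_mapsTo`, general position by
  `exists_isSmoothEmbedding_of_stagesGoodOn_two_arcs`);
* `exists_coreLoop` — **the embedded core loop**: for disjoint knots `K₁`, `K₂`, a closed set
  `avoid` missing both and a path off `avoid` between their base points, there are tubular
  neighbourhoods `ν₁`, `ν₂`, a radius `r` whose closed tubes miss `avoid`, the other knot and
  each other, a margin `h`, and a knot `e` which is the radial segment of `ν₁` through `K₁ (1, 0)`
  near the angle `0`, the radial segment of `ν₂` through `K₂ (1, 0)` near the angle `π`, misses
  `avoid`, and meets `Kᵢ` only at those angles.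

Everything here is proved; no definitions, no named facts.

## References

* R. E. Gompf, A. I. Stipsicz, *4-Manifolds and Kirby Calculus*, GSM 20, AMS (1999), §5.1
  (band sums along a band `b` connecting two components and disjoint from the rest).
  [GompfStipsicz1999]
* J. Milnor, *Lectures on the h-cobordism theorem* (1965), proof of Lemma 8.3 (PDF p. 56) and
  Lemma 6.12 (PDF p. 42) (closing an arc to an embedded circle by general position).
  [MilnorHCobordism1965]
* M. W. Hirsch, *Differential Topology*, GTM 33 (1976), Ch. 4 §5 (tubular neighbourhoods).
  [HirschDT1976]
-/

open scoped Manifold ContDiff Topology Real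
open Function Set Filter Metric

noncomputable section

namespace Literature.Topology.FourManifolds

/-! ### The punctured disc is path connected -/

section Punctured

/-- **The punctured open disc `B(0, r) ∖ {0} ⊆ ℝ²` is path connected** (`r > 0`): every point
`w` is joined to the point `(r/2) w / ‖w‖` of the middle circle by a radial segment, and the
middle circle is connected. [folklore] -/
theorem isPathConnected_ball_diff_zero {r : ℝ} (hr : 0 < r) :
    IsPathConnected (ball (0 : EuclideanSpace ℝ (Fin 2)) r \ {0}) := by
  -- the middle circle, image of `ℝ` under `θ ↦ (r/2) • circlePoint θ`
  set C : Set (EuclideanSpace ℝ (Fin 2)) := range fun θ : ℝ => (r / 2) • ((circlePoint θ : (Metric.sphere (0 : EuclideanSpace ℝ (Fin 2)) 1)) : EuclideanSpace ℝ (Fin 2)) with hC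
  have hCsub : C ⊆ ball (0 : EuclideanSpace ℝ (Fin 2)) r \ {0} := by
    rintro _ ⟨θ, rfl⟩
    have hn : ‖(r / 2) • ((circlePoint θ : (Metric.sphere (0 : EuclideanSpace ℝ (Fin 2)) 1)) : EuclideanSpace ℝ (Fin 2))‖ = r / 2 := by
      rw [norm_smul, norm_eq_of_mem_sphere (circlePoint θ), mul_one, Real.norm_eq_abs,
        abs_of_pos (by positivity)]
    refine ⟨?_, ?_⟩
    · rw [mem_ball_zero_iff, hn]; linarith
    · rw [mem_singleton_iff, ← norm_eq_zero, hn]; positivity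
  have hCconn : IsPathConnected C :=
    isPathConnected_range (f := fun θ : ℝ => (r / 2) • ((circlePoint θ : (Metric.sphere (0 : EuclideanSpace ℝ (Fin 2)) 1)) : EuclideanSpace ℝ (Fin 2)))
      ((continuous_subtype_val.comp continuous_circlePoint).const_smul (r / 2))
  -- every point of the punctured disc is joined to the circle by a radial segment
  have hrad : ∀ w ∈ ball (0 : EuclideanSpace ℝ (Fin 2)) r \ {0},
      JoinedIn (ball (0 : EuclideanSpace ℝ (Fin 2)) r \ {0}) w ((r / 2 * ‖w‖⁻¹) • w) := by
    rintro w ⟨hw, hw0⟩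
    rw [mem_singleton_iff] at hw0
    have hwpos : 0 < ‖w‖ := norm_pos_iff.2 hw0
    rw [mem_ball_zero_iff] at hw
    refine JoinedIn.ofLine (f := fun t : ℝ => (1 - t + t * (r / 2 * ‖w‖⁻¹)) • w)
      (by fun_prop) (by simp) (by simp) ?_
    rintro _ ⟨t, ⟨ht0, ht1⟩, rfl⟩
    have hcoef : 0 < 1 - t + t * (r / 2 * ‖w‖⁻¹) := by
      have : 0 ≤ t * (r / 2 * ‖w‖⁻¹) := by positivity
      rcases eq_or_lt_of_le ht1 with rfl | ht1'
      · have : 0 < r / 2 * ‖w‖⁻¹ := by positivity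
        linarith
      · linarith
    have hn : ‖(1 - t + t * (r / 2 * ‖w‖⁻¹)) • w‖ = (1 - t + t * (r / 2 * ‖w‖⁻¹)) * ‖w‖ := by
      rw [norm_smul, Real.norm_eq_abs, abs_of_pos hcoef]
    refine ⟨?_, ?_⟩
    · rw [mem_ball_zero_iff, hn]
      have h1 : (1 - t + t * (r / 2 * ‖w‖⁻¹)) * ‖w‖ = (1 - t) * ‖w‖ + t * (r / 2) := by
        field_simp
      rw [h1]
      nlinarith
    · rw [mem_singleton_iff, ← norm_eq_zero, hn]
      positivity
  -- assemble
  refine ⟨(r / 2) • ((circlePoint 0 : (Metric.sphere (0 : EuclideanSpace ℝ (Fin 2)) 1)) : EuclideanSpace ℝ (Fin 2)), hCsub ⟨0, rfl⟩, fun w hw => ?_⟩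
  have hmem : (r / 2 * ‖w‖⁻¹) • w ∈ C := by
    have hw0 : w ≠ 0 := fun h => hw.2 (by rw [mem_singleton_iff]; exact h)
    have hwpos : 0 < ‖w‖ := norm_pos_iff.2 hw0
    have hunit : ‖w‖⁻¹ • w ∈ Metric.sphere (0 : EuclideanSpace ℝ (Fin 2)) 1 := by
      rw [mem_sphere_zero_iff_norm, norm_smul, norm_inv, norm_norm, inv_mul_cancel₀ hwpos.ne']
    obtain ⟨θ, hθ⟩ := circlePoint_surjective ⟨‖w‖⁻¹ • w, hunit⟩
    refine ⟨θ, ?_⟩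
    change (r / 2) • ((circlePoint θ : (Metric.sphere (0 : EuclideanSpace ℝ (Fin 2)) 1)) : EuclideanSpace ℝ (Fin 2)) = (r / 2 * ‖w‖⁻¹) • w
    rw [hθ, mul_smul]
  exact ((hCconn.joinedIn _ ⟨0, rfl⟩ _ hmem).mono hCsub).trans ((hrad w hw).symm)

end Punctured

/-! ### Tubes about a knot -/

namespace Knot.TubularNbhd

variable {K : (Metric.sphere (0 : EuclideanSpace ℝ (Fin 2)) 1) → (Metric.sphere (0 : EuclideanSpace ℝ (Fin 4)) 1)} (ν : Knot.TubularNbhd K)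

/-- **A closed set missing the knot misses a closed tube about it**: if `F` is closed and
disjoint from `range K = ν (S¹ × 0)`, then for some `r > 0` no point `ν (x, w)` with `‖w‖ ≤ r`
lies in `F` (tube lemma for the compact zero section inside the open set `ν⁻¹ Fᶜ`). [folklore] -/
theorem exists_radius_forall_notMem {F : Set (Metric.sphere (0 : EuclideanSpace ℝ (Fin 4)) 1)} (hF : IsClosed F)
    (hKF : Disjoint (range K) F) :
    ∃ r > 0, ∀ (x : (Metric.sphere (0 : EuclideanSpace ℝ (Fin 2)) 1)) (w : EuclideanSpace ℝ (Fin 2)), ‖w‖ ≤ r → ν (x, w) ∉ F := by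
  have hopen : IsOpen (ν ⁻¹' Fᶜ) := hF.isOpen_compl.preimage ν.continuous
  have hsub : (univ : Set (Metric.sphere (0 : EuclideanSpace ℝ (Fin 2)) 1)) ×ˢ ({0} : Set (EuclideanSpace ℝ (Fin 2))) ⊆ ν ⁻¹' Fᶜ := by
    rintro ⟨x, w⟩ ⟨-, hw⟩
    rw [mem_singleton_iff] at hw
    subst hw
    change ν (x, 0) ∉ F
    rw [ν.coe_apply_zero]
    exact Set.disjoint_left.1 hKF ⟨x, rfl⟩
  obtain ⟨u, v, -, hv, hu1, hv0, huv⟩ :=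
    generalized_tube_lemma isCompact_univ isCompact_singleton hopen hsub
  obtain ⟨ε, hε, hball⟩ := Metric.isOpen_iff.1 hv 0 (hv0 rfl)
  refine ⟨ε / 2, by positivity, fun x w hw hmem => ?_⟩
  have hwv : w ∈ v := hball (mem_ball_zero_iff.2 (by linarith))
  exact huv ⟨hu1 (mem_univ x), hwv⟩ hmem

/-- The closed tube `ν (S¹ × B̄(0, r))` is compact. [folklore] -/
theorem isCompact_image_closedTube (r : ℝ) :
    IsCompact (ν '' ((univ : Set (Metric.sphere (0 : EuclideanSpace ℝ (Fin 2)) 1)) ×ˢ closedBall (0 : EuclideanSpace ℝ (Fin 2)) r)) :=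
  (isCompact_univ.prod (isCompact_closedBall 0 r)).image ν.continuous

/-- The open tube `ν (S¹ × B(0, r))` is open. [folklore] -/
theorem isOpen_image_openTube (r : ℝ) :
    IsOpen (ν '' ((univ : Set (Metric.sphere (0 : EuclideanSpace ℝ (Fin 2)) 1)) ×ˢ ball (0 : EuclideanSpace ℝ (Fin 2)) r)) :=
  ν.isOpenMap _ (isOpen_univ.prod isOpen_ball)

/-- The knot lies in every open tube about it. [folklore] -/
theorem range_subset_image_openTube {r : ℝ} (hr : 0 < r) :
    range K ⊆ ν '' ((univ : Set (Metric.sphere (0 : EuclideanSpace ℝ (Fin 2)) 1)) ×ˢ ball (0 : EuclideanSpace ℝ (Fin 2)) r) := by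
  rintro _ ⟨x, rfl⟩
  exact ⟨(x, 0), ⟨mem_univ _, mem_ball_self hr⟩, ν.coe_apply_zero x⟩

/-- A point of the open tube off the knot is a point `ν (x, w)` with `0 < ‖w‖ < r`. [folklore] -/
theorem exists_eq_of_mem_image_openTube_of_notMem {r : ℝ} {p : (Metric.sphere (0 : EuclideanSpace ℝ (Fin 4)) 1)}
    (hp : p ∈ ν '' ((univ : Set (Metric.sphere (0 : EuclideanSpace ℝ (Fin 2)) 1)) ×ˢ ball (0 : EuclideanSpace ℝ (Fin 2)) r)) (hpK : p ∉ range K) :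
    ∃ (x : (Metric.sphere (0 : EuclideanSpace ℝ (Fin 2)) 1)) (w : EuclideanSpace ℝ (Fin 2)), w ∈ ball (0 : EuclideanSpace ℝ (Fin 2)) r \ {0} ∧ ν (x, w) = p := by
  obtain ⟨⟨x, w⟩, ⟨-, hw⟩, rfl⟩ := hp
  refine ⟨x, w, ⟨hw, fun hw0 => hpK ?_⟩, rfl⟩
  rw [mem_singleton_iff] at hw0
  subst hw0
  exact ⟨x, (ν.coe_apply_zero x).symm⟩

/-- **The punctured open tube is path connected**: any two points `ν (x, w)`, `ν (x', w')` with
`w, w' ∈ B(0, r) ∖ 0` are joined inside `ν (S¹ × (B(0, r) ∖ 0))`. [folklore] -/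
theorem joinedIn_image_punctured {r : ℝ} (hr : 0 < r) {x x' : (Metric.sphere (0 : EuclideanSpace ℝ (Fin 2)) 1)} {w w' : EuclideanSpace ℝ (Fin 2)}
    (hw : w ∈ ball (0 : EuclideanSpace ℝ (Fin 2)) r \ {0}) (hw' : w' ∈ ball (0 : EuclideanSpace ℝ (Fin 2)) r \ {0}) :
    JoinedIn (ν '' ((univ : Set (Metric.sphere (0 : EuclideanSpace ℝ (Fin 2)) 1)) ×ˢ (ball (0 : EuclideanSpace ℝ (Fin 2)) r \ {0}))) (ν (x, w)) (ν (x', w')) := by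
  have huniv : IsPathConnected (univ : Set (Metric.sphere (0 : EuclideanSpace ℝ (Fin 2)) 1)) := by
    have : (univ : Set (Metric.sphere (0 : EuclideanSpace ℝ (Fin 2)) 1)) = range circlePoint :=
      (range_eq_univ.2 circlePoint_surjective).symm
    rw [this]
    exact isPathConnected_range continuous_circlePoint
  have hpc : IsPathConnected ((univ : Set (Metric.sphere (0 : EuclideanSpace ℝ (Fin 2)) 1)) ×ˢ (ball (0 : EuclideanSpace ℝ (Fin 2)) r \ {0})) :=
    huniv.prod (isPathConnected_ball_diff_zero hr)
  exact (hpc.image ν.continuous).joinedIn _ ⟨(x, w), ⟨mem_univ _, hw⟩, rfl⟩ _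
    ⟨(x', w'), ⟨mem_univ _, hw'⟩, rfl⟩

/-- Points of the punctured tube are off the knot. [folklore] -/
theorem image_punctured_subset_compl (r : ℝ) :
    ν '' ((univ : Set (Metric.sphere (0 : EuclideanSpace ℝ (Fin 2)) 1)) ×ˢ (ball (0 : EuclideanSpace ℝ (Fin 2)) r \ {0})) ⊆ (range K)ᶜ := by
  rintro _ ⟨⟨x, w⟩, ⟨-, -, hw0⟩, rfl⟩
  exact ν.apply_mem_compl_range fun h => hw0 (by rw [mem_singleton_iff]; exact h)

/-- Points of the punctured tube of radius `r` are points of the closed tube of radius `r`.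
[folklore] -/
theorem image_punctured_subset_image_closedTube (r : ℝ) :
    ν '' ((univ : Set (Metric.sphere (0 : EuclideanSpace ℝ (Fin 2)) 1)) ×ˢ (ball (0 : EuclideanSpace ℝ (Fin 2)) r \ {0})) ⊆
      ν '' ((univ : Set (Metric.sphere (0 : EuclideanSpace ℝ (Fin 2)) 1)) ×ˢ closedBall (0 : EuclideanSpace ℝ (Fin 2)) r) := by
  rintro _ ⟨⟨x, w⟩, ⟨-, hw, -⟩, rfl⟩
  exact ⟨(x, w), ⟨mem_univ _, ball_subset_closedBall hw⟩, rfl⟩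

end Knot.TubularNbhd

/-! ### Path reduction: last exit from `A`, first entry into `B` -/

section PathReduction

variable {X : Type*} [TopologicalSpace X]

/-- **Path reduction.**  Let `A`, `B` be disjoint closed sets with open neighbourhoods
`UA ⊇ A`, `UB ⊇ B`, and `γ` a path from a point of `A` to a point of `B` all of whose points off
`A ∪ B` lie in `O`.  Then there are points `a ∈ UA ∩ O ∖ A` and `b ∈ UB ∩ O ∖ B` joined by a path
in `O` (the sub-path of `γ` between a parameter just after the last visit of `A` and a parameter
just before the first subsequent visit of `B`). [folklore] -/
theorem exists_joinedIn_of_path {A B O UA UB : Set X} (hA : IsClosed A) (hB : IsClosed B)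
    (hAB : Disjoint A B) (hUA : IsOpen UA) (hUB : IsOpen UB) (hAU : A ⊆ UA) (hBU : B ⊆ UB)
    {p q : X} (hp : p ∈ A) (hq : q ∈ B) (γ : Path p q)
    (hO : ∀ t, γ t ∉ A → γ t ∉ B → γ t ∈ O) :
    ∃ a b : X, a ∈ UA ∧ a ∉ A ∧ a ∈ O ∧ b ∈ UB ∧ b ∉ B ∧ b ∈ O ∧ JoinedIn O a b := by
  set f : ℝ → X := ⇑γ.extend with hf
  have hfc : Continuous f := γ.continuous_extend
  have hf0 : f 0 = p := γ.extend_zero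
  have hf1 : f 1 = q := γ.extend_one
  have hfO : ∀ t ∈ Icc (0 : ℝ) 1, f t ∉ A → f t ∉ B → f t ∈ O := by
    intro t ht
    rw [hf, Path.extend_apply γ ht]
    exact hO _
  -- ### the last visit of `A`
  set S₁ : Set ℝ := Icc 0 1 ∩ f ⁻¹' A with hS₁
  have hS₁c : IsCompact S₁ := isCompact_Icc.inter_right (hA.preimage hfc)
  have h0S₁ : (0 : ℝ) ∈ S₁ := ⟨⟨le_rfl, zero_le_one⟩, by change f 0 ∈ A; rwa [hf0]⟩
  set t₁ : ℝ := sSup S₁ with ht₁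
  have ht₁S : t₁ ∈ S₁ := hS₁c.sSup_mem ⟨0, h0S₁⟩
  have ht₁le : ∀ t ∈ S₁, t ≤ t₁ := fun t ht => le_csSup hS₁c.bddAbove ht
  have ht₁1 : t₁ < 1 := by
    rcases eq_or_lt_of_le ht₁S.1.2 with h | h
    · exfalso
      have : f 1 ∈ A := h ▸ ht₁S.2
      rw [hf1] at this
      exact Set.disjoint_left.1 hAB this hq
    · exact h
  -- ### the first visit of `B` after `t₁`
  set S₂ : Set ℝ := Icc t₁ 1 ∩ f ⁻¹' B with hS₂
  have hS₂c : IsCompact S₂ := isCompact_Icc.inter_right (hB.preimage hfc)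
  have h1S₂ : (1 : ℝ) ∈ S₂ := ⟨⟨ht₁1.le, le_rfl⟩, by change f 1 ∈ B; rwa [hf1]⟩
  set t₂ : ℝ := sInf S₂ with ht₂
  have ht₂S : t₂ ∈ S₂ := hS₂c.sInf_mem ⟨1, h1S₂⟩
  have ht₂le : ∀ t ∈ S₂, t₂ ≤ t := fun t ht => csInf_le hS₂c.bddBelow ht
  have ht₁t₂ : t₁ < t₂ := by
    rcases eq_or_lt_of_le ht₂S.1.1 with h | h
    · exfalso
      have h1 : f t₁ ∈ A := ht₁S.2
      have h2 : f t₂ ∈ B := ht₂S.2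
      rw [← h] at h2
      exact Set.disjoint_left.1 hAB h1 h2
    · exact h
  have ht₂1 : t₂ ≤ 1 := ht₂S.1.2
  have ht₁0 : 0 ≤ t₁ := ht₁S.1.1
  -- ### between `t₁` and `t₂` the path is in `O`
  have hmid : ∀ t ∈ Ioo t₁ t₂, f t ∉ A ∧ f t ∉ B ∧ f t ∈ O := by
    intro t ht
    have htI : t ∈ Icc (0 : ℝ) 1 := ⟨by linarith [ht.1], by linarith [ht.2]⟩
    have hnA : f t ∉ A := fun h => by
      have := ht₁le t ⟨htI, h⟩
      linarith [ht.1]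
    have hnB : f t ∉ B := fun h => by
      have := ht₂le t ⟨⟨ht.1.le, htI.2⟩, h⟩
      linarith [ht.2]
    exact ⟨hnA, hnB, hfO t htI hnA hnB⟩
  -- ### a parameter just after `t₁` inside `UA`, one just before `t₂` inside `UB`
  have hA1 : f t₁ ∈ UA := hAU ht₁S.2
  have hB2 : f t₂ ∈ UB := hBU ht₂S.2
  have hev₁ : ∀ᶠ t in 𝓝 t₁, f t ∈ UA := hfc.continuousAt.preimage_mem_nhds (hUA.mem_nhds hA1)
  have hev₂ : ∀ᶠ t in 𝓝 t₂, f t ∈ UB := hfc.continuousAt.preimage_mem_nhds (hUB.mem_nhds hB2)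
  obtain ⟨ε₁, hε₁, hε₁U⟩ := Metric.eventually_nhds_iff.1 hev₁
  obtain ⟨ε₂, hε₂, hε₂U⟩ := Metric.eventually_nhds_iff.1 hev₂
  set d : ℝ := min (min ε₁ ε₂) ((t₂ - t₁) / 2) / 2 with hd
  have hdpos : 0 < d := by
    have : 0 < (t₂ - t₁) / 2 := by linarith
    positivity
  have hdε₁ : d < ε₁ := by
    have h1 : min (min ε₁ ε₂) ((t₂ - t₁) / 2) ≤ ε₁ := (min_le_left _ _).trans (min_le_left _ _)
    have h2 : 0 < min (min ε₁ ε₂) ((t₂ - t₁) / 2) := by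
      have : 0 < (t₂ - t₁) / 2 := by linarith
      positivity
    rw [hd]; linarith
  have hdε₂ : d < ε₂ := by
    have h1 : min (min ε₁ ε₂) ((t₂ - t₁) / 2) ≤ ε₂ := (min_le_left _ _).trans (min_le_right _ _)
    have h2 : 0 < min (min ε₁ ε₂) ((t₂ - t₁) / 2) := by
      have : 0 < (t₂ - t₁) / 2 := by linarith
      positivity
    rw [hd]; linarith
  have hdhalf : 2 * d < t₂ - t₁ := by
    have h1 : min (min ε₁ ε₂) ((t₂ - t₁) / 2) ≤ (t₂ - t₁) / 2 := min_le_right _ _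
    rw [hd]; linarith
  set s₁ : ℝ := t₁ + d with hs₁
  set s₂ : ℝ := t₂ - d with hs₂
  have hs₁mem : s₁ ∈ Ioo t₁ t₂ := ⟨by rw [hs₁]; linarith, by rw [hs₁]; linarith⟩
  have hs₂mem : s₂ ∈ Ioo t₁ t₂ := ⟨by rw [hs₂]; linarith, by rw [hs₂]; linarith⟩
  have hs₁s₂ : s₁ < s₂ := by rw [hs₁, hs₂]; linarith
  have hs₁U : f s₁ ∈ UA := hε₁U (by rw [Real.dist_eq, hs₁, add_sub_cancel_left, abs_of_pos hdpos]; exact hdε₁)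
  have hs₂U : f s₂ ∈ UB := hε₂U (by
    rw [Real.dist_eq, hs₂, show t₂ - d - t₂ = -d by ring, abs_neg, abs_of_pos hdpos]; exact hdε₂)
  obtain ⟨hs₁A, -, hs₁O⟩ := hmid s₁ hs₁mem
  obtain ⟨-, hs₂B, hs₂O⟩ := hmid s₂ hs₂mem
  refine ⟨f s₁, f s₂, hs₁U, hs₁A, hs₁O, hs₂U, hs₂B, hs₂O, ?_⟩
  -- the sub-path of `γ` over `[s₁, s₂]`, reparametrised over `[0, 1]`
  refine JoinedIn.ofLine (f := fun u : ℝ => f (s₁ + u * (s₂ - s₁))) (by fun_prop) (by simp)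
    (by simp) ?_
  rintro _ ⟨u, ⟨hu0, hu1⟩, rfl⟩
  refine (hmid _ ⟨?_, ?_⟩).2.2
  · have : 0 ≤ u * (s₂ - s₁) := mul_nonneg hu0 (by linarith)
    linarith [hs₁mem.1]
  · have : u * (s₂ - s₁) ≤ s₂ - s₁ := by nlinarith
    linarith [hs₂mem.2]

end PathReduction

/-! ### Radial segments through a knot -/

namespace Knot.TubularNbhd

variable {K : (Metric.sphere (0 : EuclideanSpace ℝ (Fin 2)) 1) → (Metric.sphere (0 : EuclideanSpace ℝ (Fin 4)) 1)} (ν : Knot.TubularNbhd K)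

/-- The first basis vector `e₀ = (1, 0)` of the fibre `ℝ²` is a unit vector. [folklore] -/
theorem norm_single_zero_one : ‖(EuclideanSpace.single 0 1 : EuclideanSpace ℝ (Fin 2))‖ = 1 := by
  simp

/-- `e₀ ≠ 0`. [folklore] -/
theorem single_zero_one_ne_zero : (EuclideanSpace.single 0 1 : EuclideanSpace ℝ (Fin 2)) ≠ 0 := by
  rw [← norm_ne_zero_iff, norm_single_zero_one]; exact one_ne_zero

/-- **The radial segment** `t ↦ ν (circlePoint 0, (κ t) e₀)` through the base point
`K (circlePoint 0)` of the knot is `C^∞`. [folklore] -/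
theorem contMDiff_radial (κ : ℝ) :
    ContMDiff 𝓘(ℝ, ℝ) (𝓡 3) ∞
      fun t : ℝ => ν (circlePoint 0, (κ * t) • (EuclideanSpace.single 0 1 : EuclideanSpace ℝ (Fin 2))) := by
  have h2 : ContMDiff 𝓘(ℝ, ℝ) 𝓘(ℝ, EuclideanSpace ℝ (Fin 2)) ∞
      fun t : ℝ => (κ * t) • (EuclideanSpace.single 0 1 : EuclideanSpace ℝ (Fin 2)) :=
    ((contDiff_const.mul contDiff_id).smul contDiff_const).contMDiff
  have h1 : ContMDiff 𝓘(ℝ, ℝ) (𝓡 1) ∞ fun _ : ℝ => (circlePoint 0 : (Metric.sphere (0 : EuclideanSpace ℝ (Fin 2)) 1)) := contMDiff_const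
  exact ν.contMDiff.comp (h1.prodMk h2)

/-- The radial segment is injective (`κ ≠ 0`). [folklore] -/
theorem injective_radial {κ : ℝ} (hκ : κ ≠ 0) :
    Injective fun t : ℝ => ν (circlePoint 0, (κ * t) • (EuclideanSpace.single 0 1 : EuclideanSpace ℝ (Fin 2))) := by
  intro t t' h
  have h1 := congrArg Prod.snd (ν.injective h)
  have h2 : κ * t = κ * t' := smul_left_injective ℝ single_zero_one_ne_zero h1
  exact mul_left_cancel₀ hκ h2

/-- The radial segment passes through the base point of the knot at `t = 0`. [folklore] -/
theorem radial_zero (κ : ℝ) :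
    ν (circlePoint 0, (κ * 0) • (EuclideanSpace.single 0 1 : EuclideanSpace ℝ (Fin 2))) = K (circlePoint 0) := by
  rw [mul_zero, zero_smul, ν.coe_apply_zero]

/-- The fibre coordinate of the radial segment has norm `|κ t|`. [folklore] -/
theorem norm_radial_fibre (κ t : ℝ) :
    ‖(κ * t) • (EuclideanSpace.single 0 1 : EuclideanSpace ℝ (Fin 2))‖ = |κ * t| := by
  rw [norm_smul, norm_single_zero_one, mul_one, Real.norm_eq_abs]

/-- **The radial segment is an immersion**: its manifold derivative is injective (`κ ≠ 0`;
chain rule through the embedding `ν`, whose differential is injective). [folklore] -/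
theorem injective_mfderiv_radial {κ : ℝ} (hκ : κ ≠ 0) (t : ℝ) :
    Injective (mfderiv 𝓘(ℝ, ℝ) (𝓡 3)
      (fun t : ℝ => ν (circlePoint 0, (κ * t) • (EuclideanSpace.single 0 1 : EuclideanSpace ℝ (Fin 2)))) t) := by
  set e0 : EuclideanSpace ℝ (Fin 2) := EuclideanSpace.single 0 1 with he0
  have he0' : e0 ≠ 0 := single_zero_one_ne_zero
  set g' : ℝ →L[ℝ] EuclideanSpace ℝ (Fin 2) := (ContinuousLinearMap.id ℝ ℝ).smulRight (κ • e0) with hg'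
  have hlin : HasFDerivAt (fun t : ℝ => (κ * t) • e0) g' t := by
    have h := (((hasDerivAt_id t).const_mul κ).smul_const e0).hasFDerivAt
    refine h.congr_fderiv ?_
    ext1
    simp [hg', smul_smul, mul_comm]
  have hc : HasMFDerivAt 𝓘(ℝ, ℝ) (𝓡 1) (fun _ : ℝ => (circlePoint 0 : (Metric.sphere (0 : EuclideanSpace ℝ (Fin 2)) 1))) t 0 :=
    hasMFDerivAt_const _ _
  have hι := hc.prodMk hlin.hasMFDerivAt
  have hν : HasMFDerivAt ((𝓡 1).prod 𝓘(ℝ, EuclideanSpace ℝ (Fin 2))) (𝓡 3) ν (circlePoint 0, (κ * t) • e0)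
      (mfderiv ((𝓡 1).prod 𝓘(ℝ, EuclideanSpace ℝ (Fin 2))) (𝓡 3) ν (circlePoint 0, (κ * t) • e0)) :=
    ((ν.contMDiff.contMDiffAt).mdifferentiableAt (by simp)).hasMFDerivAt
  have hcomp := hν.comp t hι
  have hfun : (fun t : ℝ => ν (circlePoint 0, (κ * t) • e0)) =
      (⇑ν ∘ fun t : ℝ => ((circlePoint 0 : (Metric.sphere (0 : EuclideanSpace ℝ (Fin 2)) 1)), (κ * t) • e0)) := rfl
  rw [hfun, hcomp.mfderiv]
  refine (injective_iff_map_eq_zero _).2 fun (a : ℝ) ha => ?_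
  rw [ContinuousLinearMap.comp_apply] at ha
  have h1 := ν.injective_mfderiv_coe _ (ha.trans (map_zero _).symm)
  have h2 : g' a = 0 := congrArg Prod.snd h1
  have h3 : a • (κ • e0) = 0 := by simpa [hg'] using h2
  rcases smul_eq_zero.1 h3 with h | h
  · exact h
  · exact absurd (smul_eq_zero.1 h) (not_or.2 ⟨hκ, he0'⟩)

end Knot.TubularNbhd

/-! ### The continuous loop through two arcs -/

section Loop

variable {V : Type*} [TopologicalSpace V]

/-- **A `2π`-periodic continuous map which is `σ₁` on `[-1, 1]`, `σ₂ (· - π)` on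
`[π - 1, π + 1]`, and runs through given paths in between** (from `σ₁ 1` to `σ₂ (-1)` on
`(1, π - 1)`, from `σ₂ 1` to `σ₁ (-1)` on `(π + 1, 2π - 1)`). [folklore] -/
theorem exists_periodic_extension_two_germs {σ₁ σ₂ : ℝ → V} (h₁ : Continuous σ₁) (h₂ : Continuous σ₂)
    (pth₁ : Path (σ₁ 1) (σ₂ (-1))) (pth₂ : Path (σ₂ 1) (σ₁ (-1))) :
    ∃ P : ℝ → V, Continuous P ∧ Periodic P (2 * π) ∧
      (∀ θ ∈ Icc (-1 : ℝ) 1, P θ = σ₁ θ) ∧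
      (∀ θ ∈ Ioo (1 : ℝ) (π - 1), P θ ∈ range pth₁) ∧
      (∀ θ ∈ Icc (π - 1) (π + 1), P θ = σ₂ (θ - π)) ∧
      (∀ θ ∈ Ioo (π + 1) (2 * π - 1), P θ ∈ range pth₂) := by
  haveI : Fact (0 < 2 * π) := ⟨Real.two_pi_pos⟩
  have hπ3 : (3 : ℝ) < π := Real.pi_gt_three
  have hπ2 : (0 : ℝ) < π - 2 := by linarith
  -- one period
  set P₃ : ℝ → V := fun x => if x ≤ π + 1 then σ₂ (x - π)
    else pth₂.extend ((x - π - 1) / (π - 2)) with hP₃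
  set P₂ : ℝ → V := fun x => if x ≤ π - 1 then pth₁.extend ((x - 1) / (π - 2)) else P₃ x
    with hP₂
  set P₁ : ℝ → V := fun x => if x ≤ 1 then σ₁ x else P₂ x with hP₁
  have hP₃c : Continuous P₃ := by
    refine Continuous.if_le (h₂.comp (continuous_id.sub continuous_const))
      (pth₂.continuous_extend.comp (by fun_prop)) continuous_id continuous_const ?_
    rintro x rfl
    simp
  have hP₂c : Continuous P₂ := by
    refine Continuous.if_le (pth₁.continuous_extend.comp (by fun_prop)) hP₃c continuous_id
      continuous_const ?_
    rintro x rfl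
    have hle : π - 1 ≤ π + 1 := by linarith
    simp only [hP₃, hle, if_true]
    rw [show (π - 1 - 1) / (π - 2) = 1 by rw [div_eq_one_iff_eq hπ2.ne']; ring, Path.extend_one]
    congr 1
    ring
  have hP₁c : Continuous P₁ := by
    refine Continuous.if_le h₁ hP₂c continuous_id continuous_const ?_
    rintro x rfl
    have hle : (1 : ℝ) ≤ π - 1 := by linarith
    simp only [hP₂, hle, if_true]
    simp
  have hP₁ends : P₁ (-1) = P₁ (-1 + 2 * π) := by
    have h1 : P₁ (-1) = σ₁ (-1) := by simp [hP₁]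
    have hn1 : ¬ (-1 + 2 * π ≤ 1) := by linarith
    have hn2 : ¬ (-1 + 2 * π ≤ π - 1) := by linarith
    have hn3 : ¬ (-1 + 2 * π ≤ π + 1) := by linarith
    have h2 : P₁ (-1 + 2 * π) = pth₂.extend 1 := by
      simp only [hP₁, hP₂, hP₃, hn1, hn2, hn3, if_false]
      congr 1
      rw [div_eq_one_iff_eq hπ2.ne']
      ring
    rw [h1, h2, Path.extend_one]
  set P : ℝ → V := fun θ => AddCircle.liftIco (2 * π) (-1) P₁ (θ : AddCircle (2 * π)) with hP
  have hPc : Continuous P :=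
    (AddCircle.liftIco_continuous hP₁ends hP₁c.continuousOn).comp (AddCircle.continuous_mk' _)
  have hPper : Periodic P (2 * π) := fun θ => by
    simp only [hP]
    rw [AddCircle.coe_add_period]
  have hPeq : ∀ θ ∈ Ico (-1 : ℝ) (-1 + 2 * π), P θ = P₁ θ := fun θ hθ =>
    AddCircle.liftIco_coe_apply hθ
  refine ⟨P, hPc, hPper, fun θ hθ => ?_, fun θ hθ => ?_, fun θ hθ => ?_, fun θ hθ => ?_⟩
  · rw [hPeq θ ⟨hθ.1, by linarith [hθ.2]⟩]
    simp [hP₁, hθ.2]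
  · rw [hPeq θ ⟨by linarith [hθ.1], by linarith [hθ.2]⟩]
    have hn1 : ¬ θ ≤ 1 := not_le.2 hθ.1
    simp only [hP₁, hP₂, hn1, if_false, hθ.2.le, if_true]
    exact Path.extend_mem_range pth₁ _
  · rw [hPeq θ ⟨by linarith [hθ.1], by linarith [hθ.2]⟩]
    have hn1 : ¬ θ ≤ 1 := by intro h; linarith [hθ.1]
    simp only [hP₁, hP₂, hP₃, hn1, if_false, hθ.2, if_true]
    by_cases hθ' : θ ≤ π - 1
    · -- the junction `θ = π - 1`
      have hθeq : θ = π - 1 := le_antisymm hθ' hθ.1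
      simp only [hθ', if_true]
      rw [hθeq, show (π - 1 - 1) / (π - 2) = 1 by rw [div_eq_one_iff_eq hπ2.ne']; ring,
        Path.extend_one]
      congr 1
      ring
    · simp only [hθ', if_false]
  · rw [hPeq θ ⟨by linarith [hθ.1], by linarith [hθ.2]⟩]
    have hn1 : ¬ θ ≤ 1 := by intro h; linarith [hθ.1]
    have hn2 : ¬ θ ≤ π - 1 := by intro h; linarith [hθ.1]
    have hn3 : ¬ θ ≤ π + 1 := not_le.2 hθ.1
    simp only [hP₁, hP₂, hP₃, hn1, hn2, hn3, if_false]
    exact Path.extend_mem_range pth₂ _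

end Loop

/-! ### Two radial germs closed up to a loop: the continuous loop -/

section TwoGerms

set_option backward.isDefEq.respectTransparency false in
/-- **The continuous loop through two germs.**  Let `σ₁, σ₂ : ℝ → S³` be continuous and
injective, with `σᵢ t ∈ O` for `0 < |t| ≤ 1`, `σᵢ 0 ∉ O`, `σ₁ t ≠ σ₂ t'` for `|t|, |t'| ≤ 1`,
and let `σ₁ 1`, `σ₂ (-1)` and `σ₂ 1`, `σ₁ (-1)` be joined by paths in `O`.  Then there are a
continuous loop `L : S¹ → S³` with `L (circlePoint θ) = σ₁ θ` for `|θ| ≤ 1` and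
`L (circlePoint θ) = σ₂ (θ - π)` for `|θ - π| ≤ 1`, and a margin `0 < h ≤ 1/16`, such that `L`
maps the points at angular distance `≥ h` from `0` and `π` into `O`, and those at angular
distance `≥ 1/2` off `σ₁ [-3h, 3h] ∪ σ₂ [-3h, 3h]`. [folklore] -/
theorem exists_loop_two_germs {σ₁ σ₂ : ℝ → (Metric.sphere (0 : EuclideanSpace ℝ (Fin 4)) 1)} (hσ₁c : Continuous σ₁) (hσ₂c : Continuous σ₂)
    (hσ₁inj : Injective σ₁) (hσ₂inj : Injective σ₂) {O : Set (Metric.sphere (0 : EuclideanSpace ℝ (Fin 4)) 1)}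
    (hσ₁O : ∀ t : ℝ, t ≠ 0 → |t| ≤ 1 → σ₁ t ∈ O) (hσ₂O : ∀ t : ℝ, t ≠ 0 → |t| ≤ 1 → σ₂ t ∈ O)
    (hσ₁0 : σ₁ 0 ∉ O) (hσ₂0 : σ₂ 0 ∉ O)
    (hσ₁σ₂ : ∀ t t' : ℝ, |t| ≤ 1 → |t'| ≤ 1 → σ₁ t ≠ σ₂ t')
    (hj₁ : JoinedIn O (σ₁ 1) (σ₂ (-1))) (hj₂ : JoinedIn O (σ₂ 1) (σ₁ (-1))) :
    ∃ (L : (Metric.sphere (0 : EuclideanSpace ℝ (Fin 2)) 1) → (Metric.sphere (0 : EuclideanSpace ℝ (Fin 4)) 1)) (h : ℝ), Continuous L ∧ 0 < h ∧ h ≤ 1 / 16 ∧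
      (∀ θ : ℝ, |θ| ≤ 1 → L (circlePoint θ) = σ₁ θ) ∧
      (∀ θ : ℝ, |θ - π| ≤ 1 → L (circlePoint θ) = σ₂ (θ - π)) ∧
      MapsTo L {u | angCos 0 u ≤ Real.cos h ∧ angCos π u ≤ Real.cos h} O ∧
      MapsTo L {u | angCos 0 u ≤ Real.cos (1 / 2) ∧ angCos π u ≤ Real.cos (1 / 2)}
        (σ₁ '' Icc (-(3 * h)) (3 * h) ∪ σ₂ '' Icc (-(3 * h)) (3 * h))ᶜ := by
  have hπ3 : (3 : ℝ) < π := Real.pi_gt_three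
  have hπ4 : π < 4 := Real.pi_lt_four
  set pth₁ : Path (σ₁ 1) (σ₂ (-1)) := hj₁.somePath with hpth₁
  set pth₂ : Path (σ₂ 1) (σ₁ (-1)) := hj₂.somePath with hpth₂
  have hpathsO : range pth₁ ∪ range pth₂ ⊆ O := by
    rintro p (⟨t, rfl⟩ | ⟨t, rfl⟩)
    · exact hj₁.somePath_mem t
    · exact hj₂.somePath_mem t
  -- ### the continuous loop
  obtain ⟨P, hPc, hPper, hPσ₁, hPp₁, hPσ₂, hPp₂⟩ :=
    exists_periodic_extension_two_germs hσ₁c hσ₂c pth₁ pth₂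
  obtain ⟨L, hL⟩ := exists_fun_comp_circlePoint_eq hPper
  have hLP : L ∘ circlePoint = P := funext hL
  have hLc : Continuous L := continuous_of_comp_circlePoint (by rw [hLP]; exact hPc)
  have hLσ₁ : ∀ θ : ℝ, |θ| ≤ 1 → L (circlePoint θ) = σ₁ θ := fun θ hθ => by
    rw [hL]; exact hPσ₁ θ (abs_le.1 hθ)
  have hLσ₂ : ∀ θ : ℝ, |θ - π| ≤ 1 → L (circlePoint θ) = σ₂ (θ - π) := fun θ hθ => by
    rw [hL]
    have := abs_le.1 hθ
    exact hPσ₂ θ ⟨by linarith [this.1], by linarith [this.2]⟩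
  -- ### the margin `h`: the paths miss `σᵢ [-4h, 4h]`
  have hZ₁ : IsClosed {x : ℝ | σ₁ x ∈ range pth₁ ∪ range pth₂} :=
    ((isCompact_range pth₁.continuous).union (isCompact_range pth₂.continuous)).isClosed.preimage
      hσ₁c
  have hZ₂ : IsClosed {x : ℝ | σ₂ x ∈ range pth₁ ∪ range pth₂} :=
    ((isCompact_range pth₁.continuous).union (isCompact_range pth₂.continuous)).isClosed.preimage
      hσ₂c
  have h0Z₁ : (0 : ℝ) ∈ {x : ℝ | σ₁ x ∈ range pth₁ ∪ range pth₂}ᶜ := fun hm =>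
    hσ₁0 (hpathsO hm)
  have h0Z₂ : (0 : ℝ) ∈ {x : ℝ | σ₂ x ∈ range pth₁ ∪ range pth₂}ᶜ := fun hm =>
    hσ₂0 (hpathsO hm)
  obtain ⟨h, hh0, hh16, hhZ₁, hhZ₂⟩ : ∃ h : ℝ, 0 < h ∧ h ≤ 1 / 16 ∧
      (∀ x : ℝ, |x| ≤ 4 * h → σ₁ x ∉ range pth₁ ∪ range pth₂) ∧
      (∀ x : ℝ, |x| ≤ 4 * h → σ₂ x ∉ range pth₁ ∪ range pth₂) := by
    obtain ⟨ε₁, hε₁, hball₁⟩ := Metric.isOpen_iff.1 hZ₁.isOpen_compl 0 h0Z₁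
    obtain ⟨ε₂, hε₂, hball₂⟩ := Metric.isOpen_iff.1 hZ₂.isOpen_compl 0 h0Z₂
    refine ⟨min (min (ε₁ / 8) (ε₂ / 8)) (1 / 16), lt_min (lt_min (by linarith) (by linarith))
      (by norm_num), min_le_right _ _, fun x hx hmem => hball₁ ?_ hmem,
      fun x hx hmem => hball₂ ?_ hmem⟩
    · rw [Metric.mem_ball, Real.dist_eq, sub_zero]
      have : min (min (ε₁ / 8) (ε₂ / 8)) (1 / 16) ≤ ε₁ / 8 :=
        (min_le_left _ _).trans (min_le_left _ _)
      linarith [abs_nonneg x]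
    · rw [Metric.mem_ball, Real.dist_eq, sub_zero]
      have : min (min (ε₁ / 8) (ε₂ / 8)) (1 / 16) ≤ ε₂ / 8 :=
        (min_le_left _ _).trans (min_le_right _ _)
      linarith [abs_nonneg x]
  -- ### values of `L` on the far part
  set Wc : Set (Metric.sphere (0 : EuclideanSpace ℝ (Fin 4)) 1) := (σ₁ '' Icc (-(3 * h)) (3 * h) ∪ σ₂ '' Icc (-(3 * h)) (3 * h))ᶜ with hWcdef
  have hσ₁Wc : ∀ t : ℝ, 3 * h < |t| → |t| ≤ 1 → σ₁ t ∈ Wc := by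
    intro t ht ht1
    rintro (⟨x, hx, hxe⟩ | ⟨x, hx, hxe⟩)
    · have := hσ₁inj hxe
      subst this
      have : |x| ≤ 3 * h := abs_le.2 ⟨hx.1, hx.2⟩
      linarith
    · exact hσ₁σ₂ t x ht1 (le_trans (abs_le.2 ⟨hx.1, hx.2⟩) (by linarith)) hxe.symm
  have hσ₂Wc : ∀ t : ℝ, 3 * h < |t| → |t| ≤ 1 → σ₂ t ∈ Wc := by
    intro t ht ht1
    rintro (⟨x, hx, hxe⟩ | ⟨x, hx, hxe⟩)
    · exact hσ₁σ₂ x t (le_trans (abs_le.2 ⟨hx.1, hx.2⟩) (by linarith)) ht1 hxe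
    · have := hσ₂inj hxe
      subst this
      have : |x| ≤ 3 * h := abs_le.2 ⟨hx.1, hx.2⟩
      linarith
  have hpathWc : ∀ p ∈ range pth₁ ∪ range pth₂, p ∈ Wc := by
    intro p hp
    rintro (⟨x, hx, hxe⟩ | ⟨x, hx, hxe⟩)
    · refine hhZ₁ x ?_ (hxe ▸ hp)
      exact le_trans (abs_le.2 ⟨hx.1, hx.2⟩) (by linarith)
    · refine hhZ₂ x ?_ (hxe ▸ hp)
      exact le_trans (abs_le.2 ⟨hx.1, hx.2⟩) (by linarith)
  have hLval : ∀ θ ∈ Icc h (π - h) ∪ Icc (π + h) (2 * π - h), L (circlePoint θ) ∈ O ∧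
      (θ ∈ Icc (1 / 2) (π - 1 / 2) ∪ Icc (π + 1 / 2) (2 * π - 1 / 2) →
        L (circlePoint θ) ∈ Wc) := by
    rintro θ (⟨hθ1, hθ2⟩ | ⟨hθ1, hθ2⟩)
    · -- first half `[h, π - h]`
      by_cases hθa : θ ≤ 1
      · have hval : L (circlePoint θ) = σ₁ θ := hLσ₁ θ (abs_le.2 ⟨by linarith, hθa⟩)
        rw [hval]
        refine ⟨hσ₁O θ (by intro h0; linarith) (abs_le.2 ⟨by linarith, hθa⟩), fun hW => ?_⟩
        refine hσ₁Wc θ ?_ (abs_le.2 ⟨by linarith, hθa⟩)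
        rw [abs_of_pos (by linarith)]
        rcases hW with ⟨hw1, -⟩ | ⟨hw1, -⟩ <;> linarith
      · by_cases hθb : θ < π - 1
        · have hval : L (circlePoint θ) ∈ range pth₁ := by
            rw [hL]; exact hPp₁ θ ⟨lt_of_not_ge hθa, hθb⟩
          exact ⟨(hpathsO (Or.inl hval)), fun _ => hpathWc _ (Or.inl hval)⟩
        · rw [not_lt] at hθb
          have habs : |θ - π| ≤ 1 := abs_le.2 ⟨by linarith, by linarith⟩
          have hval : L (circlePoint θ) = σ₂ (θ - π) := hLσ₂ θ habs
          rw [hval]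
          refine ⟨hσ₂O _ (by intro h0; linarith) habs, fun hW => hσ₂Wc _ ?_ habs⟩
          rw [abs_of_neg (by linarith)]
          rcases hW with ⟨-, hw2⟩ | ⟨hw1, -⟩ <;> linarith
    · -- second half `[π + h, 2π - h]`
      by_cases hθa : θ ≤ π + 1
      · have habs : |θ - π| ≤ 1 := abs_le.2 ⟨by linarith, by linarith⟩
        have hval : L (circlePoint θ) = σ₂ (θ - π) := hLσ₂ θ habs
        rw [hval]
        refine ⟨hσ₂O _ (by intro h0; linarith) habs, fun hW => hσ₂Wc _ ?_ habs⟩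
        rw [abs_of_pos (by linarith)]
        rcases hW with ⟨-, hw2⟩ | ⟨hw1, -⟩ <;> linarith
      · by_cases hθb : θ < 2 * π - 1
        · have hval : L (circlePoint θ) ∈ range pth₂ := by
            rw [hL]; exact hPp₂ θ ⟨lt_of_not_ge hθa, hθb⟩
          exact ⟨(hpathsO (Or.inr hval)), fun _ => hpathWc _ (Or.inr hval)⟩
        · rw [not_lt] at hθb
          have habs : |θ - 2 * π| ≤ 1 := abs_le.2 ⟨by linarith, by linarith⟩
          have hval : L (circlePoint θ) = σ₁ (θ - 2 * π) := by
            rw [hL, show θ = θ - 2 * π + 2 * π by ring, hPper, add_sub_cancel_right]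
            exact hPσ₁ _ ⟨by linarith, by linarith⟩
          rw [hval]
          refine ⟨hσ₁O _ (by intro h0; linarith) habs, fun hW => hσ₁Wc _ ?_ habs⟩
          rw [abs_of_neg (by linarith)]
          rcases hW with ⟨-, hw2⟩ | ⟨-, hw2⟩ <;> linarith
  refine ⟨L, h, hLc, hh0, hh16, hLσ₁, hLσ₂, fun u hu => ?_, fun u hu => ?_⟩
  · obtain ⟨θ, hθ, rfl⟩ :=
      exists_mem_Icc_union_circlePoint_eq_of_angCos_le (b := h) (by linarith) hu.1 hu.2
    exact (hLval θ hθ).1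
  · obtain ⟨θ, hθ, rfl⟩ :=
      exists_mem_Icc_union_circlePoint_eq_of_angCos_le (b := 1 / 2) (by linarith) hu.1 hu.2
    refine (hLval θ ?_).2 hθ
    rcases hθ with ⟨hθ1, hθ2⟩ | ⟨hθ1, hθ2⟩
    · exact Or.inl ⟨by linarith, by linarith⟩
    · exact Or.inr ⟨by linarith, by linarith⟩

set_option backward.isDefEq.respectTransparency false in
/-- **The embedded loop through two germs** (general position relative to two arcs).  With
`σ₁`, `σ₂`, `O` as in `exists_loop_two_germs`, and moreover `σᵢ` smooth injective immersions
and `O` open: there is a smoothly embedded circle `e : S¹ → S³` with `e (circlePoint θ) = σ₁ θ`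
for `|θ| ≤ h`, `e (circlePoint θ) = σ₂ (θ - π)` for `|θ - π| ≤ h` (some `0 < h ≤ 1/16`), all of
whose other points lie in `O`.  Milnor (1965), proof of Lemma 8.3 with Lemma 6.12, for two
arcs. [cite: MilnorHCobordism1965, proof of Lemma 8.3 (PDF p. 56) and Lemma 6.12 (PDF p. 42)] -/
theorem exists_embedding_two_germs {σ₁ σ₂ : ℝ → (Metric.sphere (0 : EuclideanSpace ℝ (Fin 4)) 1)}
    (hσ₁s : ContMDiff 𝓘(ℝ, ℝ) (𝓡 3) ∞ σ₁) (hσ₂s : ContMDiff 𝓘(ℝ, ℝ) (𝓡 3) ∞ σ₂)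
    (hσ₁inj : Injective σ₁) (hσ₂inj : Injective σ₂)
    (hσ₁imm : ∀ t, Injective (mfderiv 𝓘(ℝ, ℝ) (𝓡 3) σ₁ t))
    (hσ₂imm : ∀ t, Injective (mfderiv 𝓘(ℝ, ℝ) (𝓡 3) σ₂ t))
    {O : Set (Metric.sphere (0 : EuclideanSpace ℝ (Fin 4)) 1)} (hO : IsOpen O)
    (hσ₁O : ∀ t : ℝ, t ≠ 0 → |t| ≤ 1 → σ₁ t ∈ O) (hσ₂O : ∀ t : ℝ, t ≠ 0 → |t| ≤ 1 → σ₂ t ∈ O)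
    (hσ₁0 : σ₁ 0 ∉ O) (hσ₂0 : σ₂ 0 ∉ O)
    (hσ₁σ₂ : ∀ t t' : ℝ, |t| ≤ 1 → |t'| ≤ 1 → σ₁ t ≠ σ₂ t')
    (hj₁ : JoinedIn O (σ₁ 1) (σ₂ (-1))) (hj₂ : JoinedIn O (σ₂ 1) (σ₁ (-1))) :
    ∃ (e : (Metric.sphere (0 : EuclideanSpace ℝ (Fin 2)) 1) → (Metric.sphere (0 : EuclideanSpace ℝ (Fin 4)) 1)) (h : ℝ), Manifold.IsSmoothEmbedding (𝓡 1) (𝓡 3) ∞ e ∧ 0 < h ∧ h ≤ 1 / 16 ∧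
      (∀ θ : ℝ, |θ| ≤ h → e (circlePoint θ) = σ₁ θ) ∧
      (∀ θ : ℝ, |θ - π| ≤ h → e (circlePoint θ) = σ₂ (θ - π)) ∧
      ∀ u, e u ∈ O ∨ (∃ θ : ℝ, |θ| < h ∧ circlePoint θ = u) ∨
        (∃ θ : ℝ, |θ - π| < h ∧ circlePoint θ = u) := by
  have hπ3 : (3 : ℝ) < π := Real.pi_gt_three
  have hπ4 : π < 4 := Real.pi_lt_four
  have hσ₁c : Continuous σ₁ := hσ₁s.continuous
  have hσ₂c : Continuous σ₂ := hσ₂s.continuous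
  obtain ⟨L, h, hLc, hh0, hh16, hLσ₁, hLσ₂, hLD, hLD'⟩ := exists_loop_two_germs hσ₁c hσ₂c
    hσ₁inj hσ₂inj hσ₁O hσ₂O hσ₁0 hσ₂0 hσ₁σ₂ hj₁ hj₂
  have hhπ : 2 * h < π / 2 := by linarith
  set D : Set (Metric.sphere (0 : EuclideanSpace ℝ (Fin 2)) 1) := {u | angCos 0 u ≤ Real.cos h ∧ angCos π u ≤ Real.cos h} with hDdef
  set D' : Set (Metric.sphere (0 : EuclideanSpace ℝ (Fin 2)) 1) := {u | angCos 0 u ≤ Real.cos (1 / 2) ∧ angCos π u ≤ Real.cos (1 / 2)}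
    with hD'def
  set Wc : Set (Metric.sphere (0 : EuclideanSpace ℝ (Fin 4)) 1) := (σ₁ '' Icc (-(3 * h)) (3 * h) ∪ σ₂ '' Icc (-(3 * h)) (3 * h))ᶜ with hWcdef
  have hWco : IsOpen Wc :=
    ((isCompact_Icc.image hσ₁c).union (isCompact_Icc.image hσ₂c)).isClosed.isOpen_compl
  have hDc : IsCompact D :=
    ((isClosed_le (continuous_angCos 0) continuous_const).inter
      (isClosed_le (continuous_angCos π) continuous_const)).isCompact
  have hD'c : IsCompact D' :=
    ((isClosed_le (continuous_angCos 0) continuous_const).inter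
      (isClosed_le (continuous_angCos π) continuous_const)).isCompact
  -- ### smoothness of `L` near the two arcs
  have hLsmooth₁ : ∀ θ : ℝ, |θ| < 1 → ContMDiffAt (𝓡 1) (𝓡 3) ∞ L (circlePoint θ) := by
    intro θ hθ
    apply contMDiffAt_of_comp_circlePoint
    have hev : (L ∘ circlePoint) =ᶠ[𝓝 θ] σ₁ := by
      have ho : IsOpen {x : ℝ | |x| < 1} := isOpen_lt continuous_abs continuous_const
      filter_upwards [ho.mem_nhds hθ] with x hx
      exact hLσ₁ x (le_of_lt hx)
    exact (hσ₁s θ).congr_of_eventuallyEq hev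
  have hσ₂s' : ContMDiff 𝓘(ℝ, ℝ) (𝓡 3) ∞ fun x : ℝ => σ₂ (x - π) :=
    hσ₂s.comp (contDiff_id.sub contDiff_const).contMDiff
  have hLsmooth₂ : ∀ θ : ℝ, |θ - π| < 1 → ContMDiffAt (𝓡 1) (𝓡 3) ∞ L (circlePoint θ) := by
    intro θ hθ
    apply contMDiffAt_of_comp_circlePoint
    have hev : (L ∘ circlePoint) =ᶠ[𝓝 θ] fun x => σ₂ (x - π) := by
      have ho : IsOpen {x : ℝ | |x - π| < 1} :=
        isOpen_lt (continuous_abs.comp (continuous_id.sub continuous_const)) continuous_const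
      filter_upwards [ho.mem_nhds hθ] with x hx
      exact hLσ₂ x (le_of_lt hx)
    exact (hσ₂s' θ).congr_of_eventuallyEq hev
  -- ### smoothing relative to the two arcs of angle `1/2`
  have hLW : ContMDiffOn (𝓡 1) (𝓡 3) ∞ L (circleArc 0 1 ∪ circleArc π 1) := by
    rintro u (hu | hu)
    · obtain ⟨θ, hθ, rfl⟩ := exists_abs_lt_of_mem_circleArc hu zero_le_one
      rw [sub_zero] at hθ
      exact (hLsmooth₁ θ hθ).contMDiffWithinAt
    · obtain ⟨θ, hθ, rfl⟩ := exists_abs_lt_of_mem_circleArc hu zero_le_one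
      exact (hLsmooth₂ θ hθ).contMDiffWithinAt
  have hSW : circleClosedArc 0 (1 / 2) ∪ circleClosedArc π (1 / 2) ⊆
      circleArc 0 1 ∪ circleArc π 1 :=
    union_subset_union (circleClosedArc_subset_arc (by norm_num) (by norm_num) (by linarith))
      (circleClosedArc_subset_arc (by norm_num) (by norm_num) (by linarith))
  obtain ⟨G₀, hG₀s, hG₀L, hG₀cons⟩ := exists_contMDiff_eqOn_mapsTo (IM := 𝓡 1) hLc
    ((isClosed_circleClosedArc 0 (1 / 2)).union (isClosed_circleClosedArc π (1 / 2)))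
    ((isOpen_circleArc 0 1).union (isOpen_circleArc π 1)) hSW hLW
    (ι := Bool) (C := fun b => cond b D D') (U := fun b => cond b O Wc)
    (fun b => by cases b <;> assumption) (fun b => by cases b <;> assumption)
    (fun b => by cases b <;> assumption)
  have hG₀D : MapsTo G₀ D O := hG₀cons true
  have hG₀D' : MapsTo G₀ D' Wc := hG₀cons false
  -- `G₀` on the two arcs of angle `1/2`
  have hG₀σ₁ : ∀ θ : ℝ, |θ| ≤ 1 / 2 → G₀ (circlePoint θ) = σ₁ θ := fun θ hθ => by
    rw [hG₀L (Or.inl (circlePoint_mem_circleClosedArc_of_abs_le (by rwa [sub_zero])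
      (by linarith)))]
    exact hLσ₁ θ (by linarith)
  have hG₀σ₂ : ∀ θ : ℝ, |θ - π| ≤ 1 / 2 → G₀ (circlePoint θ) = σ₂ (θ - π) := fun θ hθ => by
    rw [hG₀L (Or.inr (circlePoint_mem_circleClosedArc_of_abs_le hθ (by linarith)))]
    exact hLσ₂ θ (by linarith)
  -- ### the smoothed loop is good on the two core arcs of angle `2h`
  -- velocity on the first arc
  have hvel₁ : ∀ s : ℝ, circlePoint s ∈ circleClosedArc 0 (2 * h) →
      thetaVel 3 (fun p : ℝ × (Metric.sphere (0 : EuclideanSpace ℝ (Fin 2)) 1) => G₀ p.2) 0 s ≠ 0 := by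
    intro s hs
    have hs' : circlePoint s ∈ circleArc 0 (3 * h) :=
      circleClosedArc_subset_arc (by linarith) (by linarith) (by linarith) hs
    obtain ⟨s₀, hs₀, hs₀s⟩ := exists_abs_lt_of_mem_circleArc hs' (by linarith)
    rw [sub_zero] at hs₀
    obtain ⟨k, hk⟩ := exists_eq_add_of_circlePoint_eq hs₀s.symm
    refine thetaVel_const_ne_zero_of_eventuallyEq_curve (γ := σ₁) (d := (k : ℝ) * (2 * π))
      hσ₁s (hσ₁imm _) ?_
    have ho : IsOpen {x : ℝ | |x - (k : ℝ) * (2 * π)| < 1 / 2} :=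
      isOpen_lt (continuous_abs.comp (continuous_id.sub continuous_const)) continuous_const
    have hsmem : s ∈ {x : ℝ | |x - (k : ℝ) * (2 * π)| < 1 / 2} := by
      change |s - (k : ℝ) * (2 * π)| < 1 / 2
      rw [hk, add_sub_cancel_right]
      linarith
    filter_upwards [ho.mem_nhds hsmem] with x hx
    change G₀ (circlePoint x) = σ₁ (x - (k : ℝ) * (2 * π))
    have hcp : circlePoint x = circlePoint (x - (k : ℝ) * (2 * π)) := by
      rw [circlePoint_eq_circlePoint_iff]
      exact ⟨k, by ring⟩
    rw [hcp]
    exact hG₀σ₁ _ (le_of_lt hx)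
  -- velocity on the second arc
  have hvel₂ : ∀ s : ℝ, circlePoint s ∈ circleClosedArc π (2 * h) →
      thetaVel 3 (fun p : ℝ × (Metric.sphere (0 : EuclideanSpace ℝ (Fin 2)) 1) => G₀ p.2) 0 s ≠ 0 := by
    intro s hs
    have hs' : circlePoint s ∈ circleArc π (3 * h) :=
      circleClosedArc_subset_arc (by linarith) (by linarith) (by linarith) hs
    obtain ⟨s₀, hs₀, hs₀s⟩ := exists_abs_lt_of_mem_circleArc hs' (by linarith)
    obtain ⟨k, hk⟩ := exists_eq_add_of_circlePoint_eq hs₀s.symm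
    refine thetaVel_const_ne_zero_of_eventuallyEq_curve (γ := σ₂)
      (d := π + (k : ℝ) * (2 * π)) hσ₂s (hσ₂imm _) ?_
    have ho : IsOpen {x : ℝ | |x - (k : ℝ) * (2 * π) - π| < 1 / 2} :=
      isOpen_lt (continuous_abs.comp ((continuous_id.sub continuous_const).sub
        continuous_const)) continuous_const
    have hsmem : s ∈ {x : ℝ | |x - (k : ℝ) * (2 * π) - π| < 1 / 2} := by
      change |s - (k : ℝ) * (2 * π) - π| < 1 / 2
      rw [hk, add_sub_cancel_right]
      linarith
    filter_upwards [ho.mem_nhds hsmem] with x hx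
    change G₀ (circlePoint x) = σ₂ (x - (π + (k : ℝ) * (2 * π)))
    have hcp : circlePoint x = circlePoint (x - (k : ℝ) * (2 * π)) := by
      rw [circlePoint_eq_circlePoint_iff]
      exact ⟨k, by ring⟩
    rw [hcp, hG₀σ₂ _ (le_of_lt hx)]
    congr 1
    ring
  -- the three cases for a second point `u'`
  have hu'cases : ∀ u' : (Metric.sphere (0 : EuclideanSpace ℝ (Fin 2)) 1), (∃ θ' : ℝ, |θ'| < 3 / 4 ∧ circlePoint θ' = u' ∧ G₀ u' = σ₁ θ') ∨
      (∃ θ' : ℝ, |θ' - π| < 3 / 4 ∧ circlePoint θ' = u' ∧ G₀ u' = σ₂ (θ' - π)) ∨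
      G₀ u' ∈ Wc := by
    intro u'
    by_cases hu'1 : Real.cos (1 / 2) ≤ angCos 0 u'
    · left
      have hu'' : u' ∈ circleArc 0 (3 / 4) :=
        circleClosedArc_subset_arc (by norm_num) (by norm_num) (by linarith) hu'1
      obtain ⟨θ', hθ', rfl⟩ := exists_abs_lt_of_mem_circleArc hu'' (by norm_num)
      rw [sub_zero] at hθ'
      refine ⟨θ', hθ', rfl, ?_⟩
      rw [hG₀L (Or.inl hu'1)]
      exact hLσ₁ θ' (by linarith)
    · by_cases hu'2 : Real.cos (1 / 2) ≤ angCos π u'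
      · right; left
        have hu'' : u' ∈ circleArc π (3 / 4) :=
          circleClosedArc_subset_arc (by norm_num) (by norm_num) (by linarith) hu'2
        obtain ⟨θ', hθ', rfl⟩ := exists_abs_lt_of_mem_circleArc hu'' (by norm_num)
        refine ⟨θ', hθ', rfl, ?_⟩
        rw [hG₀L (Or.inr hu'2)]
        exact hLσ₂ θ' (by linarith)
      · right; right
        exact hG₀D' ⟨le_of_not_ge hu'1, le_of_not_ge hu'2⟩
  have hgood : StagesGoodOn 3 (fun p : ℝ × (Metric.sphere (0 : EuclideanSpace ℝ (Fin 2)) 1) => G₀ p.2)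
      (univ ×ˢ (circleClosedArc 0 (2 * h) ∪ circleClosedArc π (2 * h))) := by
    refine stagesGoodOn_const_iff.2 ⟨fun s hs => hs.elim (hvel₁ s) (hvel₂ s),
      fun u u' hu heq => ?_⟩
    rcases hu with hu | hu
    · have hu3 : u ∈ circleArc 0 (3 * h) :=
        circleClosedArc_subset_arc (by linarith) (by linarith) (by linarith) hu
      obtain ⟨θ, hθ, rfl⟩ := exists_abs_lt_of_mem_circleArc hu3 (by linarith)
      rw [sub_zero] at hθ
      have hθ1 : |θ| ≤ 1 := by linarith
      have hGu : G₀ (circlePoint θ) = σ₁ θ := hG₀σ₁ θ (by linarith)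
      rcases hu'cases u' with ⟨θ', hθ', rfl, hGu'⟩ | ⟨θ', hθ', rfl, hGu'⟩ | hW
      · rw [hGu, hGu'] at heq
        rw [hσ₁inj heq]
      · rw [hGu, hGu'] at heq
        exact absurd heq (hσ₁σ₂ θ (θ' - π) hθ1 (by linarith [abs_nonneg (θ' - π)]))
      · rw [← heq, hGu] at hW
        exact absurd (Or.inl ⟨θ, ⟨by linarith [abs_lt.1 hθ |>.1],
          by linarith [abs_lt.1 hθ |>.2]⟩, rfl⟩) hW
    · have hu3 : u ∈ circleArc π (3 * h) :=
        circleClosedArc_subset_arc (by linarith) (by linarith) (by linarith) hu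
      obtain ⟨θ, hθ, rfl⟩ := exists_abs_lt_of_mem_circleArc hu3 (by linarith)
      have hθ1 : |θ - π| ≤ 1 := by linarith
      have hGu : G₀ (circlePoint θ) = σ₂ (θ - π) := hG₀σ₂ θ (by linarith)
      rcases hu'cases u' with ⟨θ', hθ', rfl, hGu'⟩ | ⟨θ', hθ', rfl, hGu'⟩ | hW
      · rw [hGu, hGu'] at heq
        exact absurd heq.symm (hσ₁σ₂ θ' (θ - π) (by linarith [abs_nonneg θ']) hθ1)
      · rw [hGu, hGu'] at heq
        have := hσ₂inj heq
        rw [show θ = θ' by linarith]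
      · rw [← heq, hGu] at hW
        exact absurd (Or.inr ⟨θ - π, ⟨by linarith [abs_lt.1 hθ |>.1],
          by linarith [abs_lt.1 hθ |>.2]⟩, rfl⟩) hW
  -- ### general position away from the two arcs of angle `h`
  obtain ⟨e, hes, hemb, heD, heG₀⟩ := exists_isSmoothEmbedding_of_stagesGoodOn_two_arcs
    (n := 3) (by norm_num) hG₀s hh0 (by linarith) hhπ hgood (ι := Unit) (C := fun _ => D)
    (U := fun _ => O) (fun _ => hDc) (fun _ => hO) (fun _ => hG₀D)
  have heD' : MapsTo e D O := heD ()
  refine ⟨e, h, hemb, hh0, hh16, fun θ hθ => ?_, fun θ hθ => ?_, fun u => ?_⟩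
  · rw [heG₀ (Or.inl (circlePoint_mem_circleClosedArc_of_abs_le (by rwa [sub_zero])
      (by linarith)))]
    exact hG₀σ₁ θ (by linarith)
  · rw [heG₀ (Or.inr (circlePoint_mem_circleClosedArc_of_abs_le hθ (by linarith)))]
    exact hG₀σ₂ θ (by linarith)
  · by_cases hu1 : angCos 0 u ≤ Real.cos h
    · by_cases hu2 : angCos π u ≤ Real.cos h
      · exact Or.inl (heD' ⟨hu1, hu2⟩)
      · right; right
        obtain ⟨θ, hθ, rfl⟩ := exists_abs_lt_of_mem_circleArc (lt_of_not_ge hu2) hh0.le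
        exact ⟨θ, hθ, rfl⟩
    · right; left
      obtain ⟨θ, hθ, rfl⟩ := exists_abs_lt_of_mem_circleArc (lt_of_not_ge hu1) hh0.le
      rw [sub_zero] at hθ
      exact ⟨θ, hθ, rfl⟩

end TwoGerms

/-! ### The embedded core loop through both knots -/

section CoreLoop

/-- **An embedded loop crossing two disjoint knots along radial segments.**  Let `K₁`, `K₂` be
disjoint knots, `avoid` a closed set missing both, and suppose the base points `K₁ (1, 0)`,
`K₂ (1, 0)` are joined by a path off `avoid`.  Then there are tubular neighbourhoods `ν₁`, `ν₂`
of the two knots, a radius `r > 0` such that the closed tubes `νᵢ (S¹ × B̄(0, r))` miss `avoid`,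
the other knot and each other, a margin `0 < h ≤ 1/16`, and a **knot** `e : S¹ ↪ S³` (a
smoothly embedded circle) which

* near the angle `0` is the radial segment `θ ↦ ν₁ ((1, 0), (rθ/2) e₀)` through
  `K₁ (1, 0)` (for `|θ| ≤ h`), and near the angle `π` the radial segment
  `θ ↦ ν₂ ((1, 0), (r(θ - π)/2) e₀)` through `K₂ (1, 0)` (for `|θ - π| ≤ h`);
* misses `avoid`, meets `K₁` only at the angle `0` and `K₂` only at the angle `π`.

*Proof.*  Shrink the tubes off the closed sets (`exists_radius_forall_notMem`); reduce the given
path to a path in `O = avoidᶜ ∖ (K₁ ∪ K₂)` between points of the two punctured tubes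
(`exists_joinedIn_of_path`), hence (punctured tubes are path connected and lie in `O`) to paths
in `O` between the ends of the two radial segments; then `exists_embedding_two_germs` (closing
up, smoothing, general position).  This is the first step of the construction of a band from
`K₁` to `K₂` (Gompf–Stipsicz (1999), §5.1: a band connecting `K₁` and `K₂` disjoint from the
rest of the link), with the general-position argument of Milnor (1965), proof of Lemma 8.3.
[cite: GompfStipsicz1999, §5.1] -/
theorem exists_coreLoop (K₁ K₂ : Knot) (avoid : Set (Metric.sphere (0 : EuclideanSpace ℝ (Fin 4)) 1))
    (hdisj : Disjoint (range K₁) (range K₂)) (havoid : IsClosed avoid)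
    (h₁ : Disjoint (range K₁) avoid) (h₂ : Disjoint (range K₂) avoid)
    (hpath : JoinedIn avoidᶜ (K₁ (circlePoint 0)) (K₂ (circlePoint 0))) :
    ∃ (ν₁ : Knot.TubularNbhd K₁) (ν₂ : Knot.TubularNbhd K₂) (r h : ℝ) (e : Knot),
      0 < r ∧ 0 < h ∧ h ≤ 1 / 16 ∧
      (∀ (x : (Metric.sphere (0 : EuclideanSpace ℝ (Fin 2)) 1)) (w : EuclideanSpace ℝ (Fin 2)), ‖w‖ ≤ r → ν₁ (x, w) ∉ avoid ∧ ν₁ (x, w) ∉ range K₂) ∧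
      (∀ (x : (Metric.sphere (0 : EuclideanSpace ℝ (Fin 2)) 1)) (w : EuclideanSpace ℝ (Fin 2)), ‖w‖ ≤ r → ν₂ (x, w) ∉ avoid ∧ ν₂ (x, w) ∉ range K₁) ∧
      (∀ (x x' : (Metric.sphere (0 : EuclideanSpace ℝ (Fin 2)) 1)) (w w' : EuclideanSpace ℝ (Fin 2)), ‖w‖ ≤ r → ‖w'‖ ≤ r → ν₁ (x, w) ≠ ν₂ (x', w')) ∧
      (∀ θ : ℝ, |θ| ≤ h → e (circlePoint θ) =
        ν₁ (circlePoint 0, (r / 2 * θ) • (EuclideanSpace.single 0 1 : EuclideanSpace ℝ (Fin 2)))) ∧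
      (∀ θ : ℝ, |θ - π| ≤ h → e (circlePoint θ) =
        ν₂ (circlePoint 0, (r / 2 * (θ - π)) • (EuclideanSpace.single 0 1 : EuclideanSpace ℝ (Fin 2)))) ∧
      (∀ u, e u ∉ avoid) ∧
      (∀ u, e u ∈ range K₁ → u = circlePoint 0) ∧
      (∀ u, e u ∈ range K₂ → u = circlePoint π) := by
  have hπ3 : (3 : ℝ) < π := Real.pi_gt_three
  -- ### tubes missing `avoid`, the other knot, and each other
  obtain ⟨ν₁⟩ := Knot.nonempty_tubularNbhd_holds K₁
  obtain ⟨ν₂⟩ := Knot.nonempty_tubularNbhd_holds K₂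
  have hF₂ : IsClosed (avoid ∪ range K₁) := havoid.union K₁.isClosed_range
  have hKF₂ : Disjoint (range K₂) (avoid ∪ range K₁) :=
    Set.disjoint_union_right.2 ⟨h₂, hdisj.symm⟩
  obtain ⟨r₂, hr₂, hr₂F⟩ := ν₂.exists_radius_forall_notMem hF₂ hKF₂
  set T₂ : Set (Metric.sphere (0 : EuclideanSpace ℝ (Fin 4)) 1) := ν₂ '' ((univ : Set (Metric.sphere (0 : EuclideanSpace ℝ (Fin 2)) 1)) ×ˢ closedBall (0 : EuclideanSpace ℝ (Fin 2)) r₂) with hT₂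
  have hT₂c : IsCompact T₂ := ν₂.isCompact_image_closedTube r₂
  have hF₁ : IsClosed (avoid ∪ range K₂ ∪ T₂) :=
    (havoid.union K₂.isClosed_range).union hT₂c.isClosed
  have hKF₁ : Disjoint (range K₁) (avoid ∪ range K₂ ∪ T₂) := by
    refine Set.disjoint_union_right.2 ⟨Set.disjoint_union_right.2 ⟨h₁, hdisj⟩, ?_⟩
    rw [Set.disjoint_left]
    rintro _ ⟨x, rfl⟩ ⟨⟨y, w⟩, ⟨-, hw⟩, hyw⟩
    exact (hr₂F y w (mem_closedBall_zero_iff.1 hw)) (Or.inr (hyw ▸ ⟨x, rfl⟩))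
  obtain ⟨r₁, hr₁, hr₁F⟩ := ν₁.exists_radius_forall_notMem hF₁ hKF₁
  set r : ℝ := min r₁ r₂ with hr
  have hr0 : 0 < r := lt_min hr₁ hr₂
  have hrr₁ : r ≤ r₁ := min_le_left _ _
  have hrr₂ : r ≤ r₂ := min_le_right _ _
  have hT1 : ∀ (x : (Metric.sphere (0 : EuclideanSpace ℝ (Fin 2)) 1)) (w : EuclideanSpace ℝ (Fin 2)), ‖w‖ ≤ r → ν₁ (x, w) ∉ avoid ∧ ν₁ (x, w) ∉ range K₂ :=
    fun x w hw => ⟨fun h => hr₁F x w (hw.trans hrr₁) (Or.inl (Or.inl h)),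
      fun h => hr₁F x w (hw.trans hrr₁) (Or.inl (Or.inr h))⟩
  have hT2 : ∀ (x : (Metric.sphere (0 : EuclideanSpace ℝ (Fin 2)) 1)) (w : EuclideanSpace ℝ (Fin 2)), ‖w‖ ≤ r → ν₂ (x, w) ∉ avoid ∧ ν₂ (x, w) ∉ range K₁ :=
    fun x w hw => ⟨fun h => hr₂F x w (hw.trans hrr₂) (Or.inl h),
      fun h => hr₂F x w (hw.trans hrr₂) (Or.inr h)⟩
  have hT12 : ∀ (x x' : (Metric.sphere (0 : EuclideanSpace ℝ (Fin 2)) 1)) (w w' : EuclideanSpace ℝ (Fin 2)), ‖w‖ ≤ r → ‖w'‖ ≤ r → ν₁ (x, w) ≠ ν₂ (x', w') := by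
    intro x x' w w' hw hw' heq
    refine hr₁F x w (hw.trans hrr₁) (Or.inr ?_)
    rw [heq]
    exact ⟨(x', w'), ⟨mem_univ _, mem_closedBall_zero_iff.2 (hw'.trans hrr₂)⟩, rfl⟩
  -- ### the open set `O` and the punctured tubes
  set O : Set (Metric.sphere (0 : EuclideanSpace ℝ (Fin 4)) 1) := avoidᶜ ∩ (range K₁)ᶜ ∩ (range K₂)ᶜ with hOdef
  have hO : IsOpen O :=
    (havoid.isOpen_compl.inter K₁.isClosed_range.isOpen_compl).inter
      K₂.isClosed_range.isOpen_compl
  have hP₁O : ν₁ '' ((univ : Set (Metric.sphere (0 : EuclideanSpace ℝ (Fin 2)) 1)) ×ˢ (ball (0 : EuclideanSpace ℝ (Fin 2)) r \ {0})) ⊆ O := by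
    rintro _ ⟨⟨x, w⟩, ⟨-, hw, hw0⟩, rfl⟩
    have hwr : ‖w‖ ≤ r := (mem_ball_zero_iff.1 hw).le
    exact ⟨⟨(hT1 x w hwr).1, ν₁.apply_mem_compl_range fun h => hw0 (by
      rw [mem_singleton_iff]; exact h)⟩, (hT1 x w hwr).2⟩
  have hP₂O : ν₂ '' ((univ : Set (Metric.sphere (0 : EuclideanSpace ℝ (Fin 2)) 1)) ×ˢ (ball (0 : EuclideanSpace ℝ (Fin 2)) r \ {0})) ⊆ O := by
    rintro _ ⟨⟨x, w⟩, ⟨-, hw, hw0⟩, rfl⟩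
    have hwr : ‖w‖ ≤ r := (mem_ball_zero_iff.1 hw).le
    exact ⟨⟨(hT2 x w hwr).1, (hT2 x w hwr).2⟩, ν₂.apply_mem_compl_range fun h => hw0 (by
      rw [mem_singleton_iff]; exact h)⟩
  -- ### path reduction
  obtain ⟨a, b, haU, haK, haO, hbU, hbK, hbO, hab⟩ := exists_joinedIn_of_path
    K₁.isClosed_range K₂.isClosed_range hdisj (ν₁.isOpen_image_openTube r) (ν₂.isOpen_image_openTube r)
    (ν₁.range_subset_image_openTube hr0) (ν₂.range_subset_image_openTube hr0) ⟨circlePoint 0, rfl⟩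
    ⟨circlePoint 0, rfl⟩ hpath.somePath (O := O)
    (fun t ht₁ ht₂ => ⟨⟨hpath.somePath_mem t, ht₁⟩, ht₂⟩)
  obtain ⟨xa, wa, hwa, rfl⟩ := ν₁.exists_eq_of_mem_image_openTube_of_notMem haU haK
  obtain ⟨xb, wb, hwb, rfl⟩ := ν₂.exists_eq_of_mem_image_openTube_of_notMem hbU hbK
  -- ### the radial segments and the paths between their ends
  set κ : ℝ := r / 2 with hκ
  have hκ0 : 0 < κ := by positivity
  have hκne : κ ≠ 0 := hκ0.ne'
  set e0 : EuclideanSpace ℝ (Fin 2) := EuclideanSpace.single 0 1 with he0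
  set σ₁ : ℝ → (Metric.sphere (0 : EuclideanSpace ℝ (Fin 4)) 1) := fun t => ν₁ (circlePoint 0, (κ * t) • e0) with hσ₁
  set σ₂ : ℝ → (Metric.sphere (0 : EuclideanSpace ℝ (Fin 4)) 1) := fun t => ν₂ (circlePoint 0, (κ * t) • e0) with hσ₂
  have hσ₁s : ContMDiff 𝓘(ℝ, ℝ) (𝓡 3) ∞ σ₁ := ν₁.contMDiff_radial κ
  have hσ₂s : ContMDiff 𝓘(ℝ, ℝ) (𝓡 3) ∞ σ₂ := ν₂.contMDiff_radial κ
  have hσ₁inj : Injective σ₁ := ν₁.injective_radial hκne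
  have hσ₂inj : Injective σ₂ := ν₂.injective_radial hκne
  have hσ₁imm : ∀ t, Injective (mfderiv 𝓘(ℝ, ℝ) (𝓡 3) σ₁ t) :=
    fun t => ν₁.injective_mfderiv_radial hκne t
  have hσ₂imm : ∀ t, Injective (mfderiv 𝓘(ℝ, ℝ) (𝓡 3) σ₂ t) :=
    fun t => ν₂.injective_mfderiv_radial hκne t
  have hnormκ : ∀ t : ℝ, |t| ≤ 1 → ‖(κ * t) • e0‖ ≤ r := fun t ht => by
    rw [Knot.TubularNbhd.norm_radial_fibre, abs_mul, abs_of_pos hκ0]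
    have : κ * |t| ≤ κ := by nlinarith
    linarith
  have hpunct : ∀ t : ℝ, t ≠ 0 → |t| ≤ 1 → (κ * t) • e0 ∈ ball (0 : EuclideanSpace ℝ (Fin 2)) r \ {0} := by
    intro t ht0 ht
    refine ⟨?_, ?_⟩
    · rw [mem_ball_zero_iff, Knot.TubularNbhd.norm_radial_fibre, abs_mul, abs_of_pos hκ0]
      have : κ * |t| ≤ κ := by nlinarith
      linarith
    · rw [mem_singleton_iff, smul_eq_zero, not_or]
      exact ⟨mul_ne_zero hκne ht0, Knot.TubularNbhd.single_zero_one_ne_zero⟩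
  have hσ₁O : ∀ t : ℝ, t ≠ 0 → |t| ≤ 1 → σ₁ t ∈ O := fun t ht0 ht =>
    hP₁O ⟨(circlePoint 0, (κ * t) • e0), ⟨mem_univ _, hpunct t ht0 ht⟩, rfl⟩
  have hσ₂O : ∀ t : ℝ, t ≠ 0 → |t| ≤ 1 → σ₂ t ∈ O := fun t ht0 ht =>
    hP₂O ⟨(circlePoint 0, (κ * t) • e0), ⟨mem_univ _, hpunct t ht0 ht⟩, rfl⟩
  have hσ₁σ₂ : ∀ t t' : ℝ, |t| ≤ 1 → |t'| ≤ 1 → σ₁ t ≠ σ₂ t' := fun t t' ht ht' =>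
    hT12 _ _ _ _ (hnormκ t ht) (hnormκ t' ht')
  have hσ₁0 : σ₁ 0 ∈ range K₁ := ⟨circlePoint 0, (ν₁.radial_zero κ).symm⟩
  have hσ₂0 : σ₂ 0 ∈ range K₂ := ⟨circlePoint 0, (ν₂.radial_zero κ).symm⟩
  have hσ₁0' : σ₁ 0 ∉ O := fun h => h.1.2 hσ₁0
  have hσ₂0' : σ₂ 0 ∉ O := fun h => h.2 hσ₂0
  -- paths in `O` from `σ₁ 1` to `σ₂ (-1)` and from `σ₂ 1` to `σ₁ (-1)`
  have hone : |(1 : ℝ)| ≤ 1 := by norm_num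
  have hneg : |(-1 : ℝ)| ≤ 1 := by norm_num
  have hj₁ : JoinedIn O (σ₁ 1) (σ₂ (-1)) := by
    have ha' : JoinedIn O (σ₁ 1) (ν₁ (xa, wa)) :=
      (ν₁.joinedIn_image_punctured hr0 (hpunct 1 one_ne_zero hone) hwa).mono hP₁O
    have hb' : JoinedIn O (ν₂ (xb, wb)) (σ₂ (-1)) :=
      (ν₂.joinedIn_image_punctured hr0 hwb (hpunct (-1) (by norm_num) hneg)).mono hP₂O
    exact (ha'.trans hab).trans hb'
  have hj₂ : JoinedIn O (σ₂ 1) (σ₁ (-1)) := by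
    have hb' : JoinedIn O (σ₂ 1) (ν₂ (xb, wb)) :=
      (ν₂.joinedIn_image_punctured hr0 (hpunct 1 one_ne_zero hone) hwb).mono hP₂O
    have ha' : JoinedIn O (ν₁ (xa, wa)) (σ₁ (-1)) :=
      (ν₁.joinedIn_image_punctured hr0 hwa (hpunct (-1) (by norm_num) hneg)).mono hP₁O
    exact (hb'.trans hab.symm).trans ha'
  -- ### the embedded loop
  obtain ⟨e, h, hemb, hh0, hh16, heσ₁, heσ₂, htri⟩ := exists_embedding_two_germs hσ₁s hσ₂s
    hσ₁inj hσ₂inj hσ₁imm hσ₂imm hO hσ₁O hσ₂O hσ₁0' hσ₂0' hσ₁σ₂ hj₁ hj₂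
  -- ### assembly
  refine ⟨ν₁, ν₂, r, h, ⟨e, hemb⟩, hr0, hh0, hh16, hT1, hT2, hT12, fun θ hθ => ?_,
    fun θ hθ => ?_, fun u => ?_, fun u hu => ?_, fun u hu => ?_⟩
  · -- germ at `K₁`
    change e (circlePoint θ) = _
    rw [heσ₁ θ hθ]
  · -- germ at `K₂`
    change e (circlePoint θ) = _
    rw [heσ₂ θ hθ]
  · -- off `avoid`
    change e u ∉ avoid
    rcases htri u with hu | ⟨θ, hθ, rfl⟩ | ⟨θ, hθ, rfl⟩
    · exact fun ha => hu.1.1 ha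
    · rw [heσ₁ θ hθ.le]
      exact (hT1 _ _ (hnormκ θ (by linarith))).1
    · rw [heσ₂ θ hθ.le]
      exact (hT2 _ _ (hnormκ (θ - π) (by linarith))).1
  · -- meets `K₁` only at the angle `0`
    change e u ∈ range K₁ at hu
    rcases htri u with hu' | ⟨θ, hθ, rfl⟩ | ⟨θ, hθ, rfl⟩
    · exact absurd hu hu'.1.2
    · rw [heσ₁ θ hθ.le] at hu
      by_contra hne
      have hθ0 : θ ≠ 0 := by
        rintro rfl
        exact hne rfl
      exact (hσ₁O θ hθ0 (by linarith)).1.2 hu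
    · rw [heσ₂ θ hθ.le] at hu
      exact absurd hu (hT2 _ _ (hnormκ (θ - π) (by linarith))).2
  · -- meets `K₂` only at the angle `π`
    change e u ∈ range K₂ at hu
    rcases htri u with hu' | ⟨θ, hθ, rfl⟩ | ⟨θ, hθ, rfl⟩
    · exact absurd hu hu'.2
    · rw [heσ₁ θ hθ.le] at hu
      exact absurd hu (hT1 _ _ (hnormκ θ (by linarith))).2
    · rw [heσ₂ θ hθ.le] at hu
      by_contra hne
      have hθ0 : θ - π ≠ 0 := by
        intro h0
        apply hne
        rw [show θ = π by linarith]
      exact (hσ₂O (θ - π) hθ0 (by linarith)).2 hu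

end CoreLoop

end Literature.Topology.FourManifolds
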